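import Mathlib
import Summits.MatrixMultiplication.MatrixMultiplication.Theorems.HiddenToeplitzCornersHiddenCornerLemmaRHConst
import Summits.MatrixMultiplication.MatrixMultiplication.Theorems.HiddenToeplitzCornersHiddenCornerLemmaRGConstD1
import Summits.MatrixMultiplication.MatrixMultiplication.Theorems.HiddenToeplitzCornersHiddenCornerLemmaRLoToolkit
import Summits.MatrixMultiplication.MatrixMultiplication.Theorems.HiddenToeplitzCornersHiddenCornerLemmaRMixedNF2

/-!
# Mixed law, the full `(p,q) = (1,1)` class (hidden-corner lemma, crux stmt-MatrixMultiplication-10752)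

Support file for crux item `stmt-MatrixMultiplication-10752`
(`Summit.MatrixMultiplication.MatrixMultiplication.Theses.HiddenToeplitzCorners.HiddenCornerLemmaR`),
line `frobenius-dual-short-syzygies`, stub `stub_mixedLaw`.

**`stub_mixedLaw` for `(p,q) = (1,1)`, with no further hypothesis**: a generically nonsingular
pencil with `∇(T a b) = g ⊗ h a b + k a b ⊗ w` (one constant left generator `g`, one constant
right generator `w`, both arbitrary) hiding a linearly explained corner with rank-`r` frames has
`r ≤ 2` (`hclR_mixed_one_one_bound`), in particular `r ≤ 2p + q = 3` (`hclR_mixed_one_one_stub`,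
the registered stub with `p = 1`, `q = 1` added).  The bound `2` is sharp (`ToeplitzCornerTwo`).

* `hclR_nf_bound` — the law in normal form `g = e_γ`, `w = e_ω`.  Assembly: degenerate cuts
  (`γ ≥ N`: H-constant class, `hclR_hconst_bound`; `ω ≥ N`: column class, `hclR_gconst_d_one`);
  `hclR_nf_F_top` (targets below row `γ`, by `hclR_relvis_bound`), `hclR_nf_E_mid` (frame off
  rows `[ω, ω+γ)`), `hclR_nf_cut_le` (`γ + ω ≤ N`), `hclR_nf_F_deep` (targets off rows `≥ γ + ω`:
  three honest Toeplitz slots, `hclR_toeplitz_three_slot` — the only place where `3 ≤ r` is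
  used), `hclR_nf_low_of_mid` (frame below row `ω`), `hclR_nf_low_bound` (valuations).
* `hclR_mixed_one_one_bound` — general `g`, `w`: `g = 0` is the H-constant class, `w = 0` the
  column class; otherwise, with `γ`, `ω` the valuations of `g`, `w`, the invertible
  lower-triangular Toeplitz matrices `Lo a`, `Lo b` with `Lo a · g = e_γ`, `Lo b · w = e_ω`
  (`HiddenCornerLemmaRLoToolkit`) conjugate the pencil into normal form,
  `∇(Lo a · T a b · Lo bᵀ) = e_γ ⊗ (Lo b · h a b) + (Lo a · k a b) ⊗ e_ω`, hiding the corner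
  `(Lo bᵀ)⁻¹ E ↦ (Lo a) F` with the same ranks and nonsingularity.
-/

set_option linter.dupNamespace false

namespace Summit.MatrixMultiplication.MatrixMultiplication.Theorems

open Matrix BigOperators Finset

/-- **The `(1,1)` mixed law in normal form.**  If every coefficient matrix of the pencil has
displacement `∇(T a b) = e_γ ⊗ h a b + k a b ⊗ e_ω`, the pencil hides a linearly explained corner
`T(X) E = F X` with frames of rank `r`, and some `T(X₀)` is nonsingular, then `r ≤ 2`. -/
theorem hclR_nf_bound :
    ∀ (r N γ ω : ℕ) (T : Fin r → Fin r → Matrix (Fin N) (Fin N) ℂ)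
      (E F : Matrix (Fin N) (Fin r) ℂ) (h k : Fin r → Fin r → Fin N → ℂ),
      E.rank = r → F.rank = r →
      (∀ X : Matrix (Fin r) (Fin r) ℂ, (∑ a : Fin r, ∑ b : Fin r, X a b • T a b) * E = F * X) →
      (∀ a b, T a b - (Matrix.of fun i j : Fin N => if (i : ℕ) = (j : ℕ) + 1 then (1 : ℂ) else 0) *
          T a b * (Matrix.of fun i j : Fin N => if (i : ℕ) = (j : ℕ) + 1 then (1 : ℂ) else 0)ᵀ =
        Matrix.vecMulVec (fun i : Fin N => if (i : ℕ) = γ then (1 : ℂ) else 0) (h a b) +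
          Matrix.vecMulVec (k a b) (fun j : Fin N => if (j : ℕ) = ω then (1 : ℂ) else 0)) →
      (∃ X₀ : Matrix (Fin r) (Fin r) ℂ, (∑ a : Fin r, ∑ b : Fin r, X₀ a b • T a b).det ≠ 0) →
      r ≤ 2 := by
  intro r N γ ω T E F h k hE hF hcorner hdisp hns
  by_contra hr
  push Not at hr
  have hN0 : 0 < N := by
    rcases Nat.eq_zero_or_pos N with h0 | h0
    · subst h0
      have : E.rank ≤ 0 := by simpa using Matrix.rank_le_card_height E
      omega
    · exact h0
  have hFne : F ≠ 0 := by
    intro h0; rw [h0, Matrix.rank_zero] at hF; omega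
  have hvec : ∀ u v : Fin N → ℂ, Matrix.vecMulVec u v =
      Matrix.replicateCol (Fin 1) u * (Matrix.replicateCol (Fin 1) v)ᵀ := by
    intro u v; ext i j; simp [Matrix.vecMulVec_apply, Matrix.mul_apply]
  -- degenerate cuts
  rcases le_or_gt N γ with hγN | hγN
  · -- `e_γ = 0`: H-constant class, `r ≤ 1`
    have h0 : (fun i : Fin N => if (i : ℕ) = γ then (1 : ℂ) else 0) = 0 := by
      funext i; rw [if_neg (by omega)]; rfl
    have hle := hclR_hconst_bound r N 1 T E F
      (Matrix.replicateCol (Fin 1) (fun j : Fin N => if (j : ℕ) = ω then (1 : ℂ) else 0))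
      (fun a b => Matrix.replicateCol (Fin 1) (k a b)) hFne hcorner
      (by intro a b; rw [hdisp a b, h0, Matrix.zero_vecMulVec, zero_add, hvec])
    omega
  rcases le_or_gt N ω with hωN | hωN
  · -- `e_ω = 0`: column class, `r ≤ 1`
    have h0 : (fun j : Fin N => if (j : ℕ) = ω then (1 : ℂ) else 0) = 0 := by
      funext j; rw [if_neg (by omega)]; rfl
    have hle := hclR_gconst_d_one r N T E F hE hF (fun i : Fin N => if (i : ℕ) = γ then (1 : ℂ) else 0) h
      (by intro a b; rw [hdisp a b, h0, Matrix.vecMulVec_zero, add_zero]) hcorner hns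
    omega
  -- the main line
  have hFtop := hclR_nf_F_top r N γ ω T E F h k (by omega) hcorner hdisp
  obtain ⟨X₀, hX₀⟩ := hns
  set M := ∑ a : Fin r, ∑ b : Fin r, X₀ a b • T a b with hMdef
  set κ : Fin N → ℂ := ∑ a : Fin r, ∑ b : Fin r, X₀ a b • k a b with hκ
  set η : Fin N → ℂ := ∑ a : Fin r, ∑ b : Fin r, X₀ a b • h a b with hη
  have hMdisp := hclR_nf_disp_sum T _ _ h k hdisp X₀
  rw [← hMdef, ← hη, ← hκ] at hMdisp
  have hMent := hclR_nf_entry γ ω M η κ hMdisp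
  have hinj : Function.Injective M.mulVec :=
    Matrix.mulVec_injective_iff_isUnit.mpr
      ((Matrix.isUnit_iff_isUnit_det M).mpr (isUnit_iff_ne_zero.mpr hX₀))
  have hEmid : ∀ (m : Fin N) (c : Fin r), ω ≤ (m : ℕ) → (m : ℕ) < ω + γ → E m c = 0 := by
    rcases Nat.eq_zero_or_pos γ with hγ0 | hγ0
    · intro m c h1 h2; omega
    · exact hclR_nf_E_mid r N γ ω T E F h k hγ0 hcorner hdisp hFtop X₀ hX₀
  have hcut := hclR_nf_cut_le γ ω M η κ hMent (by omega) (by omega) hinj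
  have hFdeep := hclR_nf_F_deep r N γ ω T E F h k hr hcut hcorner hdisp hEmid
  have hElow : ∀ (m : Fin N) (c : Fin r), ω ≤ (m : ℕ) → E m c = 0 := by
    intro m c hm
    refine hclR_nf_low_of_mid γ ω M η κ hMent hcut hinj (fun i => E i c) ?_ m hm
    intro n hn
    have hc := hcorner X₀
    rw [← hMdef] at hc
    have hc' := congr_fun (congr_fun hc n) c
    rw [Matrix.mul_apply, Matrix.mul_apply] at hc'
    have e : (M *ᵥ fun i => E i c) n = ∑ j, M n j * E j c := rfl
    rw [e, hc']
    refine Finset.sum_eq_zero fun a _ => ?_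
    rcases hn with hn | hn
    · rw [hFtop n a hn, zero_mul]
    · rw [hFdeep n a hn, zero_mul]
  have hle := hclR_nf_low_bound r N γ ω T E F h k hcut hE hF hcorner hdisp hElow hFtop
  omega

/-- **The `(1,1)` mixed law.**  A pencil with `∇(T a b) = g ⊗ h a b + k a b ⊗ w` (constant `g`,
`w`) hiding a linearly explained corner `T(X) E = F X` with frames of rank `r`, some `T(X₀)`
nonsingular, has `r ≤ 2`. -/
theorem hclR_mixed_one_one_bound (r N : ℕ) (T : Fin r → Fin r → Matrix (Fin N) (Fin N) ℂ)
    (E F : Matrix (Fin N) (Fin r) ℂ) (g w : Fin N → ℂ) (h k : Fin r → Fin r → Fin N → ℂ)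
    (hE : E.rank = r) (hF : F.rank = r)
    (hcorner : ∀ X : Matrix (Fin r) (Fin r) ℂ, (∑ a : Fin r, ∑ b : Fin r, X a b • T a b) * E = F * X)
    (hdisp : ∀ a b, T a b - (Matrix.of fun i j : Fin N => if (i : ℕ) = (j : ℕ) + 1 then (1 : ℂ) else 0) *
        T a b * (Matrix.of fun i j : Fin N => if (i : ℕ) = (j : ℕ) + 1 then (1 : ℂ) else 0)ᵀ
        = Matrix.vecMulVec g (h a b) + Matrix.vecMulVec (k a b) w)
    (hns : ∃ X₀ : Matrix (Fin r) (Fin r) ℂ, (∑ a : Fin r, ∑ b : Fin r, X₀ a b • T a b).det ≠ 0) :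
    r ≤ 2 := by
  rcases Nat.eq_zero_or_pos N with hN | hN
  · subst hN
    have : F.rank ≤ 0 := by simpa using Matrix.rank_le_card_height F
    omega
  rcases Nat.eq_zero_or_pos r with hr | hr
  · omega
  have hFne : F ≠ 0 := by
    intro h0; rw [h0, Matrix.rank_zero] at hF; omega
  have hvec : ∀ u v : Fin N → ℂ, Matrix.vecMulVec u v =
      Matrix.replicateCol (Fin 1) u * (Matrix.replicateCol (Fin 1) v)ᵀ := by
    intro u v; ext i j; simp [Matrix.vecMulVec_apply, Matrix.mul_apply]
  set Z : Matrix (Fin N) (Fin N) ℂ :=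
    Matrix.of fun i j : Fin N => if (i : ℕ) = (j : ℕ) + 1 then (1 : ℂ) else 0 with hZ
  -- degenerate generators
  by_cases hg0 : g = 0
  · have hle := hclR_hconst_bound r N 1 T E F (Matrix.replicateCol (Fin 1) w)
      (fun a b => Matrix.replicateCol (Fin 1) (k a b)) hFne hcorner
      (by intro a b; rw [hdisp a b, hg0, Matrix.zero_vecMulVec, zero_add, hvec])
    omega
  by_cases hw0 : w = 0
  · have hle := hclR_gconst_d_one r N T E F hE hF g h
      (by intro a b; rw [hdisp a b, hw0, Matrix.vecMulVec_zero, add_zero]) hcorner hns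
    omega
  -- valuations and normalising factors
  obtain ⟨γ, gt, hγN, hgt0, hggt⟩ := hclR_lo_val_split hN g hg0
  obtain ⟨ω, wt, hωN, hwt0, hwwt⟩ := hclR_lo_val_split hN w hw0
  obtain ⟨a, ha⟩ := hclR_lo_inv hN gt hgt0
  obtain ⟨b, hb⟩ := hclR_lo_inv hN wt hwt0
  set La : Matrix (Fin N) (Fin N) ℂ := Matrix.of fun i j : Fin N => if (j : ℕ) ≤ (i : ℕ) then
      a ⟨(i : ℕ) - j, Nat.lt_of_le_of_lt (Nat.sub_le _ _) i.2⟩ else 0 with hLa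
  set Lb : Matrix (Fin N) (Fin N) ℂ := Matrix.of fun i j : Fin N => if (j : ℕ) ≤ (i : ℕ) then
      b ⟨(i : ℕ) - j, Nat.lt_of_le_of_lt (Nat.sub_le _ _) i.2⟩ else 0 with hLb
  have hshift_e0 : ∀ c : ℕ, Z ^ c *ᵥ (Pi.single ⟨0, hN⟩ 1 : Fin N → ℂ) =
      fun i : Fin N => if (i : ℕ) = c then (1 : ℂ) else 0 := by
    intro c; funext i
    rw [hZ, hclR_shift_pow_mulVec]
    by_cases hc : c ≤ (i : ℕ)
    · rw [dif_pos hc, Pi.single_apply]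
      by_cases hi : (i : ℕ) = c
      · rw [if_pos hi, if_pos (Fin.ext (by simp only; omega))]
      · rw [if_neg hi, if_neg (fun h' => hi (by have := congrArg Fin.val h'; simp only at this; omega))]
    · rw [dif_neg hc, if_neg (by omega)]
  have hag : La *ᵥ g = fun i : Fin N => if (i : ℕ) = γ then (1 : ℂ) else 0 := by
    rw [hggt, Matrix.mulVec_mulVec, ← ((hclR_commute_shift_lo a).pow_left γ).eq, ← Matrix.mulVec_mulVec,
      hclR_lo_mulVec_comm hN, ha]
    exact hshift_e0 γ
  have hbw : Lb *ᵥ w = fun j : Fin N => if (j : ℕ) = ω then (1 : ℂ) else 0 := by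
    rw [hwwt, Matrix.mulVec_mulVec, ← ((hclR_commute_shift_lo b).pow_left ω).eq, ← Matrix.mulVec_mulVec,
      hclR_lo_mulVec_comm hN, hb]
    exact hshift_e0 ω
  have ha0 : a ⟨0, hN⟩ ≠ 0 := by
    intro h0
    have e := congr_fun ha ⟨0, hN⟩
    rw [hclR_lo_mulVec, Finset.sum_eq_single ⟨0, hN⟩] at e
    · simp [h0] at e
    · intro j _ hj; rw [if_neg]; intro hle; apply hj; ext; simp only at hle ⊢; omega
    · simp
  have hb0 : b ⟨0, hN⟩ ≠ 0 := by
    intro h0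
    have e := congr_fun hb ⟨0, hN⟩
    rw [hclR_lo_mulVec, Finset.sum_eq_single ⟨0, hN⟩] at e
    · simp [h0] at e
    · intro j _ hj; rw [if_neg]; intro hle; apply hj; ext; simp only at hle ⊢; omega
    · simp
  have hLaU : IsUnit La := hclR_lo_isUnit hN a ha0
  have hLbU : IsUnit Lb := hclR_lo_isUnit hN b hb0
  have hLadet : IsUnit La.det := (Matrix.isUnit_iff_isUnit_det _).mp hLaU
  have hLbTU : IsUnit Lbᵀ.det := by
    rw [Matrix.det_transpose]; exact (Matrix.isUnit_iff_isUnit_det _).mp hLbU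
  have hZa : Z * La = La * Z := by rw [hZ, hLa]; exact (hclR_commute_shift_lo a).eq
  have hZb : Lbᵀ * Zᵀ = Zᵀ * Lbᵀ := by
    rw [← Matrix.transpose_mul, ← Matrix.transpose_mul, hZ, hLb, (hclR_commute_shift_lo b).eq]
  -- the transformed instance
  set T' : Fin r → Fin r → Matrix (Fin N) (Fin N) ℂ := fun a' b' => La * T a' b' * Lbᵀ with hT'
  set E' : Matrix (Fin N) (Fin r) ℂ := Lbᵀ⁻¹ * E with hE'
  set F' : Matrix (Fin N) (Fin r) ℂ := La * F with hF'
  have hF'rank : F'.rank = r := by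
    rw [hF', Matrix.rank_mul_eq_right_of_isUnit_det La F hLadet, hF]
  have hE'rank : E'.rank = r := by
    rw [hE', Matrix.rank_mul_eq_right_of_isUnit_det _ E
      ((Matrix.isUnit_nonsing_inv_det_iff (A := Lbᵀ)).mpr hLbTU), hE]
  have hsum : ∀ X : Matrix (Fin r) (Fin r) ℂ,
      (∑ a' : Fin r, ∑ b' : Fin r, X a' b' • T' a' b') =
        La * (∑ a' : Fin r, ∑ b' : Fin r, X a' b' • T a' b') * Lbᵀ := by
    intro X
    simp only [hT', Matrix.mul_sum, Matrix.sum_mul, Matrix.mul_smul, Matrix.smul_mul]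
  have hcorner' : ∀ X : Matrix (Fin r) (Fin r) ℂ,
      (∑ a' : Fin r, ∑ b' : Fin r, X a' b' • T' a' b') * E' = F' * X := by
    intro X
    rw [hsum X, hE', hF', Matrix.mul_assoc, ← Matrix.mul_assoc Lbᵀ, Matrix.mul_nonsing_inv _ hLbTU,
      Matrix.one_mul, Matrix.mul_assoc, hcorner X, Matrix.mul_assoc]
  have hdisp' : ∀ a' b', T' a' b' - Z * T' a' b' * Zᵀ =
      Matrix.vecMulVec (fun i : Fin N => if (i : ℕ) = γ then (1 : ℂ) else 0) (Lb *ᵥ h a' b') +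
        Matrix.vecMulVec (La *ᵥ k a' b') (fun j : Fin N => if (j : ℕ) = ω then (1 : ℂ) else 0) := by
    intro a' b'
    have e1 : Z * T' a' b' * Zᵀ = La * (Z * T a' b' * Zᵀ) * Lbᵀ := by
      simp only [hT']
      calc Z * (La * T a' b' * Lbᵀ) * Zᵀ = (Z * La) * T a' b' * (Lbᵀ * Zᵀ) := by
            simp only [Matrix.mul_assoc]
        _ = (La * Z) * T a' b' * (Zᵀ * Lbᵀ) := by rw [hZa, hZb]
        _ = La * (Z * T a' b' * Zᵀ) * Lbᵀ := by simp only [Matrix.mul_assoc]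
    have e2 : T' a' b' - Z * T' a' b' * Zᵀ = La * (T a' b' - Z * T a' b' * Zᵀ) * Lbᵀ := by
      rw [e1]; simp only [hT', Matrix.mul_sub, Matrix.sub_mul]
    rw [e2, hZ, hdisp a' b', Matrix.mul_add, Matrix.add_mul, Matrix.mul_vecMulVec, Matrix.vecMulVec_mul,
      Matrix.mul_vecMulVec, Matrix.vecMulVec_mul, Matrix.vecMul_transpose, Matrix.vecMul_transpose, hag, hbw]
  have hns' : ∃ X₀ : Matrix (Fin r) (Fin r) ℂ, (∑ a' : Fin r, ∑ b' : Fin r, X₀ a' b' • T' a' b').det ≠ 0 := by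
    obtain ⟨X₀, hX₀⟩ := hns
    refine ⟨X₀, ?_⟩
    rw [hsum X₀, Matrix.det_mul, Matrix.det_mul]
    exact mul_ne_zero (mul_ne_zero hLadet.ne_zero hX₀) hLbTU.ne_zero
  exact hclR_nf_bound r N γ ω T' E' F' (fun a' b' => Lb *ᵥ h a' b') (fun a' b' => La *ᵥ k a' b')
    hE'rank hF'rank hcorner' (by intro a' b'; rw [hZ] at hdisp'; exact hdisp' a' b') hns'

/-- **`stub_mixedLaw` for `(p,q) = (1,1)`** (the stub's exact binders and hypotheses, plus `p = 1`
and `q = 1`): `r ≤ 2 ≤ 2p + q`. -/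
theorem hclR_mixed_one_one_stub :
    ∀ (r N p q : ℕ) (T : Fin r → Fin r → Matrix (Fin N) (Fin N) ℂ) (E F : Matrix (Fin N) (Fin r) ℂ)
      (G₀ : Matrix (Fin N) (Fin p) ℂ) (H₀ : Matrix (Fin N) (Fin q) ℂ)
      (H₁ : Fin r → Fin r → Matrix (Fin N) (Fin p) ℂ) (G₁ : Fin r → Fin r → Matrix (Fin N) (Fin q) ℂ),
      p = 1 → q = 1 → 0 < p → 0 < q → E.rank = r → F.rank = r →
      (∀ X : Matrix (Fin r) (Fin r) ℂ, (∑ a : Fin r, ∑ b : Fin r, X a b • T a b) * E = F * X) →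
      (∀ a b, T a b - (Matrix.of fun i j : Fin N => if (i : ℕ) = (j : ℕ) + 1 then (1 : ℂ) else 0) * T a b *
          (Matrix.of fun i j : Fin N => if (i : ℕ) = (j : ℕ) + 1 then (1 : ℂ) else 0)ᵀ
          = G₀ * (H₁ a b)ᵀ + G₁ a b * H₀ᵀ) →
      (∃ X₀ : Matrix (Fin r) (Fin r) ℂ, (∑ a : Fin r, ∑ b : Fin r, X₀ a b • T a b).det ≠ 0) →
      r ≤ 2 * p + q := by
  intro r N p q T E F G₀ H₀ H₁ G₁ hp1 hq1 _hp _hq hE hF hcorner hdisp hns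
  subst hp1; subst hq1
  have hvec : ∀ (A B : Matrix (Fin N) (Fin 1) ℂ),
      A * Bᵀ = Matrix.vecMulVec (fun i => A i 0) (fun j => B j 0) := by
    intro A B; ext i j; simp [Matrix.mul_apply, Matrix.vecMulVec_apply]
  have hle := hclR_mixed_one_one_bound r N T E F (fun i => G₀ i 0) (fun j => H₀ j 0)
    (fun a b j => H₁ a b j 0) (fun a b i => G₁ a b i 0) hE hF hcorner
    (fun a b => by rw [hdisp a b, hvec, hvec]) hns
  omega


/-- **`stub_mixedLaw` for rank-one constant generators** (any `p, q ≥ 1`): if the constant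
generator matrices factor as `G₀ = g ⊗ c`, `H₀ = w ⊗ d` (all columns proportional), the class is
effectively `(1,1)` and `r ≤ 2 ≤ 2p + q`. -/
theorem hclR_mixed_rank_one_stub :
    ∀ (r N p q : ℕ) (T : Fin r → Fin r → Matrix (Fin N) (Fin N) ℂ) (E F : Matrix (Fin N) (Fin r) ℂ)
      (G₀ : Matrix (Fin N) (Fin p) ℂ) (H₀ : Matrix (Fin N) (Fin q) ℂ)
      (H₁ : Fin r → Fin r → Matrix (Fin N) (Fin p) ℂ) (G₁ : Fin r → Fin r → Matrix (Fin N) (Fin q) ℂ),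
      (∃ (g : Fin N → ℂ) (c : Fin p → ℂ), G₀ = Matrix.vecMulVec g c) →
      (∃ (w : Fin N → ℂ) (d : Fin q → ℂ), H₀ = Matrix.vecMulVec w d) →
      0 < p → 0 < q → E.rank = r → F.rank = r →
      (∀ X : Matrix (Fin r) (Fin r) ℂ, (∑ a : Fin r, ∑ b : Fin r, X a b • T a b) * E = F * X) →
      (∀ a b, T a b - (Matrix.of fun i j : Fin N => if (i : ℕ) = (j : ℕ) + 1 then (1 : ℂ) else 0) * T a b *
          (Matrix.of fun i j : Fin N => if (i : ℕ) = (j : ℕ) + 1 then (1 : ℂ) else 0)ᵀ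
          = G₀ * (H₁ a b)ᵀ + G₁ a b * H₀ᵀ) →
      (∃ X₀ : Matrix (Fin r) (Fin r) ℂ, (∑ a : Fin r, ∑ b : Fin r, X₀ a b • T a b).det ≠ 0) →
      r ≤ 2 * p + q := by
  intro r N p q T E F G₀ H₀ H₁ G₁ hG hH hp _hq hE hF hcorner hdisp hns
  obtain ⟨g, c, rfl⟩ := hG
  obtain ⟨w, d, rfl⟩ := hH
  have hle := hclR_mixed_one_one_bound r N T E F g w (fun a b => H₁ a b *ᵥ c) (fun a b => G₁ a b *ᵥ d)
    hE hF hcorner (fun a b => by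
      rw [hdisp a b, Matrix.vecMulVec_mul, Matrix.vecMul_transpose, Matrix.transpose_vecMulVec,
        Matrix.mul_vecMulVec]) hns
  omega

end Summit.MatrixMultiplication.MatrixMultiplication.Theorems
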